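import Literature.Computability.FineGrained.SerfSNPSparsifyProofs
import Literature.Computability.FineGrained.SerfSNPProofs
import Literature.Computability.FineGrained.FineGrainedWave0Proofs
import Literature.Computability.Cryptography.SubexponentialProofs
import HarnessLib

/-!
# ETH in the SE/SERF model: `ETH ↔ 3-SAT ∉ SE` for both parameters (discharge)

Third sibling proof file of `SerfSNP.lean` (D-0014; the siblings `SerfSNPProofs.lean` and
`SerfSNPSparsifyProofs.lean` discharge the two SERF reductions between the parameters `n` and `m`).
It discharges

* `Literature.Computability.FineGrained.eth_iff_kSATParam_three_not_mem_SE_holds :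
  eth_iff_kSATParam_three_not_mem_SE` — `ETH ↔ kSATParam 3 ∉ SE`: the `Wave0` formulation of ETH
  (`¬ KSATInExpTime 3 δ` for some `δ > 0`: no multi-stack machine decides the `Γ'`-coded `3`-CNFs
  `KCNF.encode φ` in time `2^{δ n} · poly(L)`) agrees with non-membership in `SE` of the
  `{0,1}`-coded parameterised problem `kSATParam 3` (language `kSAT 3`, parameter `CNF.numVars`);
* `Literature.Computability.FineGrained.eth_iff_kSATClauseParam_not_mem_SE_holds :
  eth_iff_kSATClauseParam_not_mem_SE` — `ETH ↔ kSATClauseParam 3 ∉ SE` (Impagliazzo–Paturi–Zane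
  2001, Corollary 2: ETH iff `3`-SAT with parameter `m`, i.e. linear-size `3`-SAT, is not
  subexponential).

## The proofs

Corollary 2 is, as printed, the combination of the sparsification lemma in the form "`k`-SAT with
parameter `n` SERF-reduces to `k`-SAT with parameter `m`" (Cor. 1), the trivial converse reduction,
and the closure of `SE` under SERF reductions (§2.1); these three are the tree's
`serfReducible_kSATParam_kSATClauseParam_holds`, `serfReducible_kSATClauseParam_kSATParam_holds` and
`mem_SE_of_serfReducible_holds`, so `kSATParam 3 ∈ SE ↔ kSATClauseParam 3 ∈ SE`
(`SerfKSat.EthBridge.kSATParam_mem_SE_iff`). What is left is the bridge between the two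
formalisations of "3-SAT is subexponential" (`¬ ETH`, `not_eth_iff`, versus `kSATParam 3 ∈ SE`),
an encoding/machine-model change assembled from the tree's toolkit (sequential composition
`Turing.TM2ComputableAux.comp_outputsWithin`, finite-state transducers `FST.timeComputable_eval`,
structured stack programs `ACom.exists_computesInTime`, the context machine
`SerfKSat.ctx_outputsWithin`); no Turing machine is written:

* `SE → ¬ ETH` (`SerfKSat.EthBridge.kSATInExpTime_of_mem_SE`): a `Γ'`-machine for `3`-CNFs is the
  transcoder `KCNF.encode φ ↦ encodingCNF.encode φ.clauses` (`SerfKSat.EthBridge.exists_toCode`: lift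
  to `Option Γ'`, append the terminator of the back end `SerfKSat.Post.prog` of the sparsification
  SERF machine and run that back end on the one-formula list `[φ]`, which emits the Boolean CNF code
  of formula `0` as its query; project and drop the query tag) followed by an `SE`-decider of
  `kSAT 3` for the exponent `δ`; `CNF.numVars φ.clauses ≤ φ.numVars` and the code has length
  `≤ 12 L`, so the time is `2^{δ n} · poly(L)`.
* `¬ ETH → SE` (`SerfKSat.EthBridge.mem_SE_of_forall_kSATInExpTime`): an `SE`-decider for exponent
  `ε` is the front end of the sparsification SERF machine (`SerfKSat.inT`, `SerfKSat.preFn`,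
  `SerfKSat.midT`: from a string `x` to the `Γ'`-code of the `3`-CNF `SerfKSat.kcnfOf 3 x` plus a
  well-formedness flag), the compaction machine (`Compaction.kCNF_compact_computable_holds`, so that
  the number of variables handed over is at most the parameter `CNF.numVars` of `x`,
  `SerfKSat.numVars_compact_kcnfOf_le`), the `Γ'`-machine of `KSATInExpTime 3 ε`, and a two-bit
  conjunction of its answer with the flag (`SerfKSat.EthBridge.finT`).

## References

* R. Impagliazzo, R. Paturi, F. Zane, *Which problems have strongly exponential complexity?*,
  J. Comput. System Sci. 63 (2001) 512–530, doi:10.1006/jcss.2001.1774, §2: Corollary 1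
  (sparsification), Corollary 2 (ETH ⇔ linear-size 3-SAT requires `2^{Ω(n)}`; equivalently 3-SAT
  with parameter `m` is SERF-equivalent to 3-SAT with parameter `n`), §2.1 (SE is closed under
  SERF reductions). [ImpagliazzoPaturiZaneJCSS2001; not held — statement as vendored in
  `SerfSNP.lean`]
* R. Impagliazzo, R. Paturi, *On the complexity of k-SAT*, J. Comput. System Sci. 62 (2001), §1
  (ETH as `s_3 > 0`). [ImpagliazzoPaturiJCSS2001]
* S. Arora, B. Barak, *Computational Complexity: A Modern Approach*, CUP 2009, §1.3 (composition of
  machines, robustness of encodings).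
-/

noncomputable section

namespace Literature.Computability.FineGrained

open _root_.Computability Complexity Cryptography Turing

namespace SerfKSat

namespace EthBridge

/-! ### Four small transducers -/

/-- Lifting a `Γ'`-word to `Option Γ'` (`γ ↦ some γ`). [folklore] -/
def liftT : FST Unit Γ' (Option Γ') where
  init := ()
  step := fun _ γ => ((), [some γ])
  front := fun _ => []
  keep := fun _ => true

/-- `liftT` lifts. [folklore] -/
theorem liftT_eval (w : List Γ') : liftT.eval w = w.map some := by
  have : ∀ w : List Γ', liftT.run () w = ((), w.map some) := by
    intro w
    induction w with
    | nil => rfl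
    | cons γ w ih => rw [FST.run_cons, show liftT.step () γ = ((), [some γ]) from rfl, ih]; rfl
  rw [FST.eval, this w]; rfl

/-- A bit word as `Γ'`-bits (`b ↦ bit b`). [folklore] -/
def bitT : FST Unit Bool Γ' where
  init := ()
  step := fun _ b => ((), [Γ'.bit b])
  front := fun _ => []
  keep := fun _ => true

/-- `bitT` on a word. [folklore] -/
theorem bitT_eval (l : List Bool) : bitT.eval l = l.map Γ'.bit := by
  have : ∀ l : List Bool, bitT.run () l = ((), l.map Γ'.bit) := by
    intro l
    induction l with
    | nil => rfl
    | cons b l ih => rw [FST.run_cons, show bitT.step () b = ((), [Γ'.bit b]) from rfl, ih]; rfl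
  rw [FST.eval, this l]; rfl

/-- Dropping the first bit of a word (state: whether a bit has been dropped). [folklore] -/
def dropT : FST Bool Bool Bool where
  init := false
  step := fun s b => if s then (true, [b]) else (true, [])
  front := fun _ => []
  keep := fun _ => true

/-- `dropT` drops the first bit. [folklore] -/
theorem dropT_eval (b : Bool) (l : List Bool) : dropT.eval (b :: l) = l := by
  have : ∀ l : List Bool, dropT.run true l = (true, l) := by
    intro l
    induction l with
    | nil => rfl
    | cons b l ih => rw [FST.run_cons, show dropT.step true b = (true, [b]) from rfl, ih]; rfl
  rw [FST.eval, FST.run_cons, show dropT.step dropT.init b = (true, []) from rfl, this l]; rfl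

/-- States of the final conjunction: nothing read, the answer bit read, done. [folklore] -/
inductive SF | s0 | s1 (b : Bool) | s2
  deriving DecidableEq, Fintype

/-- Transition of the final conjunction: remember the answer bit `b`, skip `none`, and on the
flag `g` emit `g && b`. [folklore] -/
def finStep : SF → Option Γ' → SF × List Bool
  | .s0, some (Γ'.bit b) => (.s1 b, [])
  | .s1 b, none => (.s1 b, [])
  | .s1 b, some (Γ'.bit g) => (.s2, [g && b])
  | _, _ => (.s2, [])

/-- **The final conjunction** of the answer bit with the well-formedness flag. [folklore] -/
def finT : FST SF (Option Γ') Bool where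
  init := .s0
  step := finStep
  front := fun _ => []
  keep := fun _ => true

/-- `finT` on the word produced by the pipeline: answer, separator, flag, separator. [folklore] -/
theorem finT_eval (b g : Bool) :
    finT.eval [some (Γ'.bit b), none, some (Γ'.bit g), none] = [g && b] := by
  simp [FST.eval, finT, finStep]

/-! ### Appending a fixed word: a three-register stack program -/

/-- Registers of the appending program. [folklore] -/
inductive R3 | inp | mid | out
  deriving DecidableEq, Fintype

/-- `appProg s`: append the fixed word `s` to the input (pour the input on the middle register,
push `s`, pour back). [folklore] -/
def appProg {A : Type} (s : List A) : ACom A R3 :=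
  ACom.pour .inp .mid ;; (ACom.pushList .mid s ;; ACom.pour .mid .out)

/-- Effect and cost of `appProg`. [folklore] -/
theorem runs_appProg {A : Type} (s w : List A) :
    ACom.Runs (appProg s) (AStore.single .inp w) (AStore.single .out (w ++ s))
      (6 * w.length + 4 * s.length + 2) := by
  set R0 : AStore A R3 := AStore.single .inp w with hR0
  have h1 := ACom.runs_pour (a := R3.inp) (b := R3.mid) (by decide) R0
  set R1 : AStore A R3 := Function.update (Function.update R0 R3.inp []) R3.mid ((R0 R3.inp).reverse ++ R0 R3.mid)
    with hR1
  have h2 := ACom.runs_pushList R3.mid s R1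
  set R2 : AStore A R3 := Function.update R1 R3.mid (s.reverse ++ R1 R3.mid) with hR2
  have h3 := ACom.runs_pour (a := R3.mid) (b := R3.out) (by decide) R2
  refine (h1.seq (h2.seq h3)).of_eq ?_ ?_
  · funext r
    cases r <;> simp [hR2, hR1, hR0, AStore.single]
  · simp [hR2, hR1, hR0, AStore.single]
    omega

/-- **The appending machine**: `w ↦ w ++ s` within `6|w| + 4|s| + 3` steps. [folklore] -/
theorem exists_appMachine {A : Type} [Fintype A] [DecidableEq A] (s : List A) :
    ∃ M : TM2ComputableAux A A, ∀ w : List A, M.OutputsWithin w (w ++ s) (6 * w.length + 4 * s.length + 3) := by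
  obtain ⟨M, hM⟩ := ACom.exists_computesInTime (appProg s) .inp .out (fun w : List A => w)
    (fun w : List A => w) (fun w => w ++ s) (fun w => 6 * w.length + 4 * s.length + 2)
    (fun w => runs_appProg s w)
  exact ⟨M, fun w => hM w⟩

/-! ### From `Γ'` to `{0,1}`: the code of the clause list of a `k`-CNF -/

/-- The terminator appended before the back end: the formula separator `blank`, the field
terminator `none`, the flag "well formed", and the separator between (no) ticks and (no) answers.
[folklore] -/
def sfx : List (Option Γ') := [some Γ'.blank, none, some (Γ'.bit true), none]

/-- The lifted `Γ'`-code followed by the terminator is the input of the back end `Post.prog` for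
the one-formula list `[φ]`, flag up, no ticks, no answers. [folklore] -/
theorem map_some_append_sfx {k : ℕ} (φ : KCNF k) :
    φ.encode.map some ++ sfx = Post.postIn [φ] true 0 [] := by
  simp [sfx, Post.postIn, KCNF.encodeList, Post.bt]

/-- The output of the back end on `[φ]`, flag up, no ticks: the query tag `0` and the Boolean code
of the clause list of formula `0`. [folklore] -/
theorem postOut_single {k : ℕ} (φ : KCNF k) :
    Post.postOut [φ] true 0 [] = false :: encodingCNF.encode φ.clauses := by
  simp [Post.postOut]

/-- **The transcoder `KCNF.encode φ ↦ encodingCNF.encode φ.clauses`** (from Wave0's `Γ'`-code of a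
`k`-CNF to the tree's Boolean CNF code of its clause list), in linear time: lift, append the
terminator, run the back end of the sparsification SERF machine on the one-formula list, project
the bits, drop the query tag. [cite: AroraBarak2009, §1.3 (composition of machines)] -/
theorem exists_toCode (k : ℕ) :
    ∃ (M : TM2ComputableAux Γ' Bool) (A : ℕ), ∀ φ : KCNF k,
      M.OutputsWithin φ.encode (encodingCNF.encode φ.clauses) (A * φ.encode.length + A) := by
  obtain ⟨M1, h1⟩ := liftT.timeComputable_eval
  obtain ⟨M2, h2⟩ := exists_appMachine sfx
  obtain ⟨M3, h3⟩ := Post.computesInTime k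
  obtain ⟨M4, h4⟩ := outT.timeComputable_eval
  obtain ⟨M5, h5⟩ := dropT.timeComputable_eval
  set c1 := liftT.maxEmit with hc1
  set c4 := outT.maxEmit with hc4
  set c5 := dropT.maxEmit with hc5
  refine ⟨(((M1.comp M2).comp M3).comp M4).comp M5, (c1 + 1) + 12 * (c4 + 1) + 12 * (c5 + 1) + 1096, fun φ => ?_⟩
  set code := encodingCNF.encode φ.clauses with hcode
  set L := φ.encode.length with hL
  -- the five stages
  have s1 : M1.OutputsWithin φ.encode (φ.encode.map some) ((c1 + 1) * L + 3) := by
    have := h1 φ.encode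
    rwa [id, liftT_eval] at this
  have s2 : M2.OutputsWithin (φ.encode.map some) (Post.postIn [φ] true 0 []) (6 * L + 19) := by
    have := h2 (φ.encode.map some)
    rw [map_some_append_sfx, List.length_map] at this
    exact this.mono (by simp [sfx, hL])
  have s3 : M3.OutputsWithin (Post.postIn [φ] true 0 []) (bitsO (false :: code))
      (200 * (Post.postIn [φ] true 0 []).length + 60 + 1) := by
    have := h3 ⟨[φ], true, 0, []⟩
    dsimp only at this
    rwa [postOut_single] at this
  have s4 : M4.OutputsWithin (bitsO (false :: code)) (false :: code) ((c4 + 1) * (bitsO (false :: code)).length + 3) := by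
    have := h4 (bitsO (false :: code))
    rwa [id, outT_eval] at this
  have s5 : M5.OutputsWithin (false :: code) code ((c5 + 1) * (false :: code).length + 3) := by
    have := h5 (false :: code)
    rwa [id, dropT_eval] at this
  have H := TM2ComputableAux.comp_outputsWithin _ M5
    (TM2ComputableAux.comp_outputsWithin _ M4
      (TM2ComputableAux.comp_outputsWithin _ M3 (TM2ComputableAux.comp_outputsWithin M1 M2 s1 s2) s3) s4) s5
  refine H.mono ?_
  -- the lengths along the pipeline
  have hQ : code.length ≤ 12 * L := by
    have := Post.length_encode_clauses_le φ.numVars φ.clauses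
    rwa [← encode_eq_kword] at this
  have hP : (Post.postIn [φ] true 0 []).length = L + 4 := by
    rw [Post.length_postIn]; simp [KCNF.encodeList, hL]
  rw [hP, length_bitsO, List.length_cons]
  have f4 : (c4 + 1) * (code.length + 1) ≤ (c4 + 1) * (12 * L + 1) := Nat.mul_le_mul_left _ (by omega)
  have f5 : (c5 + 1) * (code.length + 1) ≤ (c5 + 1) * (12 * L + 1) := Nat.mul_le_mul_left _ (by omega)
  have g4 : (c4 + 1) * (12 * L + 1) = 12 * ((c4 + 1) * L) + (c4 + 1) := by ring
  have g5 : (c5 + 1) * (12 * L + 1) = 12 * ((c5 + 1) * L) + (c5 + 1) := by ring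
  have gA : ((c1 + 1) + 12 * (c4 + 1) + 12 * (c5 + 1) + 1096) * L + ((c1 + 1) + 12 * (c4 + 1) + 12 * (c5 + 1) + 1096) =
      (c1 + 1) * L + 12 * ((c4 + 1) * L) + 12 * ((c5 + 1) * L) + 1096 * L +
        ((c1 + 1) + 12 * (c4 + 1) + 12 * (c5 + 1) + 1096) := by ring
  omega

/-- The clause list of a `k`-CNF on `numVars` variables has `CNF.numVars ≤ numVars` (`CNF.numVars`
is `1 + ` the largest occurring index). [folklore] -/
theorem numVars_clauses_le {k : ℕ} (φ : KCNF k) : CNF.numVars φ.clauses ≤ φ.numVars :=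
  (SerfRename.numVars_le_iff φ.clauses φ.numVars).2 fun l hl => by
    obtain ⟨c, hc, hl⟩ := List.mem_flatten.1 hl
    exact φ.fst_lt_numVars c hc l hl

/-- The clause list of a `k`-CNF is satisfiable (as a `CNF ℕ`) iff the `k`-CNF is. [folklore] -/
theorem satisfiable_clauses_iff {k : ℕ} (φ : KCNF k) : CNF.Satisfiable φ.clauses ↔ φ.Satisfiable := by
  rw [IPRename.satisfiable_iff_exists]; rfl

/-- The indicator of `kSAT k` on the code of the clause list of a `k`-CNF is its satisfiability
bit. [folklore] -/
theorem boolIndicator_encode_clauses {k : ℕ} (φ : KCNF k) :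
    (kSAT k).boolIndicator (encodingCNF.encode φ.clauses) = decide φ.Satisfiable := by
  have key : encodingCNF.encode φ.clauses ∈ kSAT k ↔ φ.Satisfiable := by
    rw [mem_kSAT_iff, satisfiable_clauses_iff]
    exact ⟨fun h => h.2, fun h => ⟨φ.length_le, h⟩⟩
  by_cases h : φ.Satisfiable
  · rw [decide_eq_true h]; exact ((Set.mem_iff_boolIndicator _ _).1 (key.2 h))
  · rw [decide_eq_false h]; exact ((Set.notMem_iff_boolIndicator _ _).1 fun h' => h (key.1 h'))

/-- **`kSATParam 3 ∈ SE` refutes `ETH`**: an `SE`-decider of `kSAT 3` for the exponent `δ`, run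
after the transcoder `exists_toCode`, decides the `Γ'`-coded `3`-CNFs in time `2^{δ n} · poly(L)`
(the code of the clause list has parameter `CNF.numVars ≤ n` and length `≤ 12 L`).
[cite: ImpagliazzoPaturiZaneJCSS2001, §2 (k-SAT with parameter n); AroraBarak2009, §1.3] -/
theorem kSATInExpTime_of_mem_SE (h : kSATParam 3 ∈ SE) {δ : ℝ} (hδ : 0 < δ) : KSATInExpTime 3 δ := by
  obtain ⟨T, M, ⟨c, hc⟩, hM⟩ := h δ hδ
  obtain ⟨Mt, A, hMt⟩ := exists_toCode 3
  refine ⟨fun n L => A * L + A + ⌊(c : ℝ) * (2 : ℝ) ^ (δ * n) * (((12 * L : ℕ) : ℝ) + 1) ^ c⌋₊,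
    ⟨A + 12 ^ c * c + 1, fun n L => ?_⟩, ?_⟩
  · -- the bound is `O(2^{δ n} · poly(L))`
    set C := A + 12 ^ c * c + 1 with hC
    have hL0 : (0 : ℝ) ≤ L := Nat.cast_nonneg L
    have hL1 : (1 : ℝ) ≤ (L : ℝ) + 1 := by linarith
    have h2n : (1 : ℝ) ≤ (2 : ℝ) ^ (δ * n) := Real.one_le_rpow one_le_two (mul_nonneg hδ.le (Nat.cast_nonneg n))
    have hX0 : (0 : ℝ) ≤ (c : ℝ) * (2 : ℝ) ^ (δ * n) * (((12 * L : ℕ) : ℝ) + 1) ^ c := by positivity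
    have hfloor := Nat.floor_le hX0
    have hC1 : 1 ≤ C := by omega
    have hA : ((A * L + A : ℕ) : ℝ) ≤ A * (2 : ℝ) ^ (δ * n) * ((L : ℝ) + 1) ^ C := by
      push_cast
      calc (A : ℝ) * L + A = A * 1 * ((L : ℝ) + 1) ^ 1 := by ring
        _ ≤ A * (2 : ℝ) ^ (δ * n) * ((L : ℝ) + 1) ^ C := by gcongr
    have hB : (c : ℝ) * (2 : ℝ) ^ (δ * n) * (((12 * L : ℕ) : ℝ) + 1) ^ c ≤
        (12 ^ c * c : ℕ) * (2 : ℝ) ^ (δ * n) * ((L : ℝ) + 1) ^ C := by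
      have h1 : (((12 * L : ℕ) : ℝ) + 1) ^ c ≤ (12 * ((L : ℝ) + 1)) ^ c :=
        pow_le_pow_left₀ (by positivity) (by push_cast; linarith) c
      rw [mul_pow] at h1
      have h12 : 0 < 12 ^ c := by positivity
      have hcc : c ≤ 12 ^ c * c := Nat.le_mul_of_pos_left c h12
      have h2 : ((L : ℝ) + 1) ^ c ≤ ((L : ℝ) + 1) ^ C := pow_le_pow_right₀ hL1 (by omega)
      calc (c : ℝ) * (2 : ℝ) ^ (δ * n) * (((12 * L : ℕ) : ℝ) + 1) ^ c
          ≤ (c : ℝ) * (2 : ℝ) ^ (δ * n) * ((12 : ℝ) ^ c * ((L : ℝ) + 1) ^ c) := by gcongr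
        _ ≤ (c : ℝ) * (2 : ℝ) ^ (δ * n) * ((12 : ℝ) ^ c * ((L : ℝ) + 1) ^ C) := by gcongr
        _ = ((12 ^ c * c : ℕ) : ℝ) * (2 : ℝ) ^ (δ * n) * ((L : ℝ) + 1) ^ C := by push_cast; ring
    have hsum : ((A : ℝ) + (12 ^ c * c : ℕ)) ≤ (C : ℝ) := by
      have : A + 12 ^ c * c ≤ C := by omega
      exact_mod_cast this
    have hY : 0 ≤ (2 : ℝ) ^ (δ * n) * ((L : ℝ) + 1) ^ C := by positivity
    calc (((A * L + A + ⌊(c : ℝ) * (2 : ℝ) ^ (δ * n) * (((12 * L : ℕ) : ℝ) + 1) ^ c⌋₊ : ℕ)) : ℝ)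
        = ((A * L + A : ℕ) : ℝ) + ((⌊(c : ℝ) * (2 : ℝ) ^ (δ * n) * (((12 * L : ℕ) : ℝ) + 1) ^ c⌋₊ : ℕ) : ℝ) := by
          push_cast; ring
      _ ≤ A * (2 : ℝ) ^ (δ * n) * ((L : ℝ) + 1) ^ C + (12 ^ c * c : ℕ) * (2 : ℝ) ^ (δ * n) * ((L : ℝ) + 1) ^ C :=
          add_le_add hA (hfloor.trans hB)
      _ = ((A : ℝ) + (12 ^ c * c : ℕ)) * ((2 : ℝ) ^ (δ * n) * ((L : ℝ) + 1) ^ C) := by ring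
      _ ≤ (C : ℝ) * ((2 : ℝ) ^ (δ * n) * ((L : ℝ) + 1) ^ C) := mul_le_mul_of_nonneg_right hsum hY
      _ = (C : ℝ) * (2 : ℝ) ^ (δ * n) * ((L : ℝ) + 1) ^ C := by ring
  · -- the machine: transcoder, then the `SE`-decider
    refine exists_computesInTime_iff.1 ⟨Mt.comp M, fun φ => ?_⟩
    set code := encodingCNF.encode φ.clauses with hcode
    have H₁ := hMt φ
    have H₂ : M.OutputsWithin code (encodeBool (decide φ.Satisfiable)) (T code) := by
      have := hM code
      rwa [id, kSATParam_lang, hcode, boolIndicator_encode_clauses] at this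
    have H := TM2ComputableAux.comp_outputsWithin Mt M H₁ H₂
    refine H.mono ?_
    rw [add_comm]
    refine Nat.add_le_add_left (Nat.le_floor ?_) _
    have hp : (kSATParam 3).param code ≤ φ.numVars := by
      rw [hcode, kSATParam_param_encode]; exact numVars_clauses_le φ
    have hQ : code.length ≤ 12 * φ.encode.length := by
      have := Post.length_encode_clauses_le φ.numVars φ.clauses
      rwa [← encode_eq_kword] at this
    have e1 : (2 : ℝ) ^ (δ * ((kSATParam 3).param code : ℝ)) ≤ (2 : ℝ) ^ (δ * (φ.numVars : ℝ)) :=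
      Real.rpow_le_rpow_of_exponent_le one_le_two (mul_le_mul_of_nonneg_left (by exact_mod_cast hp) hδ.le)
    have e2 : ((code.length : ℝ) + 1) ^ c ≤ (((12 * φ.encode.length : ℕ) : ℝ) + 1) ^ c :=
      pow_le_pow_left₀ (by positivity) (by exact_mod_cast Nat.succ_le_succ hQ) c
    calc (T code : ℝ) ≤ c * (2 : ℝ) ^ (δ * ((kSATParam 3).param code : ℝ)) * ((code.length : ℝ) + 1) ^ c := hc code
      _ ≤ c * (2 : ℝ) ^ (δ * (φ.numVars : ℝ)) * (((12 * φ.encode.length : ℕ) : ℝ) + 1) ^ c := by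
          gcongr

/-! ### From `{0,1}` to `Γ'`: a decider of `kSAT k` from a `Γ'`-machine for `k`-CNFs -/

/-- The fixed second field of the padded input: the code of the empty answer transcript. [folklore] -/
def tr0 : List Bool := (encodingList Bool).listBool.encode ([] : List (List Bool))

/-- The padding map `x ↦ ⟨x, tr0⟩` (so that the input splitter `inT` of the SERF step machine
applies). [cite: AroraBarak2009, §1.3] -/
def padTranscriptFn : List Bool → List Bool := fanoutFn (fun w => w) fun _ => tr0

/-- `padTranscriptFn ∈ FP`. [cite: AroraBarak2009, §1.3] -/
theorem padTranscriptFn_mem_FP : padTranscriptFn ∈ FP := fanoutFn_mem_FP OracleCompose.id_mem_FP (const_mem_FP _)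

/-- `padTranscriptFn x = ⟨x, tr0⟩`. [folklore] -/
theorem padTranscriptFn_apply (x : List Bool) : padTranscriptFn x = boolPair x tr0 := fanoutFn_apply _ _ _

/-- `|padTranscriptFn x| = 2|x| + 4`. [folklore] -/
theorem length_padTranscriptFn (x : List Bool) : (padTranscriptFn x).length = 2 * x.length + 4 := by
  rw [padTranscriptFn_apply, length_boolPair, tr0, listBool_encode_answers]
  simp

/-- The answer context of the empty transcript is one separator. [folklore] -/
theorem ansCtx_nil : ansCtx ([] : List (List Bool)) = [none] := by simp [ansCtx]

/-- **The bit computed by the decider**: the input is the code of a `k`-CNF, and the compaction of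
the formula handed over is satisfiable. [folklore] -/
def decBit (k : ℕ) (x : List Bool) : Bool :=
  decide (Good k x) && decide (KCNF.compact (kcnfOf k x)).Satisfiable

/-- **The bit computed is membership in `kSAT k`**: a good input is in `kSAT k` iff its decoded CNF —
the clause list of the formula handed over — is satisfiable, compaction preserves satisfiability,
and a bad input is not in `kSAT k`. [cite: AroraBarak2009, Def. 2.9; ImpagliazzoPaturiZaneJCSS2001, §2] -/
theorem decBit_eq_boolIndicator (k : ℕ) (x : List Bool) : decBit k x = (kSAT k).boolIndicator x := by
  unfold decBit
  by_cases hg : Good k x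
  · have key : (KCNF.compact (kcnfOf k x)).Satisfiable ↔ x ∈ kSAT k := by
      rw [KCNF.satisfiable_compact_iff, ← satisfiable_clauses_iff, kcnfOf_clauses_of_good hg,
        mem_kSAT_iff_of_good hg]
    by_cases hs : (KCNF.compact (kcnfOf k x)).Satisfiable
    · rw [decide_eq_true hg, decide_eq_true hs, Bool.true_and]
      exact ((Set.mem_iff_boolIndicator _ _).1 (key.1 hs)).symm
    · rw [decide_eq_true hg, decide_eq_false hs, Bool.true_and]
      exact ((Set.notMem_iff_boolIndicator _ _).1 fun h => hs (key.2 h)).symm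
  · rw [decide_eq_false hg, Bool.false_and]
    exact ((Set.notMem_iff_boolIndicator _ _).1 (not_mem_kSAT_of_not_good hg)).symm

/-- **The decider.** Given any `Γ'`-machine computing the satisfiability bit of `k`-CNFs
(`KCNF.encode φ ↦ encodeBool [φ satisfiable]`, time `T φ`), there is a `TM2` machine over `Bool`
which on `x` outputs `decBit k x` within `A (|x|+1)^A + T (compact (kcnfOf k x))` steps: pad, split,
front end, hand-over transducer, compaction and the given machine on the first field, conjunction
with the flag. [cite: AroraBarak2009, §1.3 (composition of machines; subroutines)] -/
theorem exists_decMachine (k : ℕ) (T : KCNF k → ℕ)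
    (hM : ∃ Md : TM2ComputableAux Γ' Bool, ∀ φ : KCNF k,
      Md.OutputsWithin φ.encode (encodeBool (decide φ.Satisfiable)) (T φ)) :
    ∃ (N : TM2ComputableAux Bool Bool) (A : ℕ), ∀ x : List Bool,
      N.OutputsWithin x [decBit k x] (A * (x.length + 1) ^ A + T (KCNF.compact (kcnfOf k x))) := by
  classical
  -- the machines of the six stages
  obtain ⟨q, Mq, hq⟩ : ∃ (q : Polynomial ℕ) (Mq : TM2ComputableAux Bool Bool),
      ∀ z, Mq.OutputsWithin z (padTranscriptFn z) (q.eval z.length) := by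
    obtain ⟨q, Mq, h⟩ := padTranscriptFn_mem_FP; exact ⟨q, Mq, h⟩
  obtain ⟨M0, h0⟩ := inT.timeComputable_eval
  obtain ⟨p, Mp, hp⟩ : ∃ (p : Polynomial ℕ) (Mp : TM2ComputableAux Bool Bool),
      ∀ z, Mp.OutputsWithin z (preFn k z) (p.eval z.length) := by
    obtain ⟨p, Mp, h⟩ := preFn_mem_FP k; exact ⟨p, Mp, h⟩
  obtain ⟨M2, h2⟩ := midT.timeComputable_eval
  obtain ⟨cc, hcc⟩ := Compaction.kCNF_compact_computable_holds k
  obtain ⟨Mc, hMc⟩ := exists_computesInTime_iff.2 hcc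
  obtain ⟨Md, hMd⟩ := hM
  obtain ⟨Mb, hb⟩ := bitT.timeComputable_eval
  obtain ⟨M5, h5⟩ := finT.timeComputable_eval
  let M1 : TM2ComputableAux (Option Bool) (Option Bool) := TM2Ctx.ctxAux (A := Bool) Mp
  let M3 : TM2ComputableAux (Option Γ') (Option Γ') := TM2Ctx.ctxAux (A := Γ') (Mc.comp (Md.comp Mb))
  let N : TM2ComputableAux Bool Bool := ((((Mq.comp M0).comp M1).comp M2).comp M3).comp M5
  -- the constants
  set c0 := inT.maxEmit with hc0
  set c2 := midT.maxEmit with hc2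
  set cb := bitT.maxEmit with hcb
  set c5 := finT.maxEmit with hc5
  set Dp := TM2Comp.machinePushBound Mp.tm with hDp
  set Dc := TM2Comp.machinePushBound Mc.tm with hDc
  -- the polynomial part of the bound (opaque local functions, so that nothing unfolds them)
  obtain ⟨E, hEdef⟩ : ∃ E : List Bool → ℕ, E = fun x => (kcnfOf k x).encode.length := ⟨_, rfl⟩
  obtain ⟨mc, hmcdef⟩ : ∃ mc : List Bool → ℕ, mc = fun x => cc * (E x + 1) ^ cc := ⟨_, rfl⟩
  obtain ⟨P, hPdef⟩ : ∃ P : List Bool → ℕ, P = fun x =>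
    q.eval x.length +
    ((c0 + 1) * (2 * x.length + 4) + 3) +
    (2 * x.length + 2 + 2 * (x.length + Dp * p.eval x.length) + p.eval x.length + 8) +
    ((c2 + 1) * (x.length + Dp * p.eval x.length + 2) + 3) +
    (2 * E x + 6 + ((cb + 1) + 3 + mc x) + 8) +
    ((c5 + 1) * 4 + 3) := ⟨_, rfl⟩
  have hE : PolyBd E := by
    refine ((PolyBd.length.const_mul 2).add_const 3).mono fun x => ?_
    rw [hEdef]; exact length_encode_kcnfOf_le k x
  have hmc : PolyBd mc := by rw [hmcdef]; exact (PolyBd.const cc).mul ((hE.add_const 1).pow cc)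
  have hP : PolyBd P := by
    have hLn := PolyBd.length
    have hPe : PolyBd fun x => p.eval x.length := PolyBd.length.poly p
    have hQe : PolyBd fun x => q.eval x.length := PolyBd.length.poly q
    have hT0 : PolyBd fun x => (c0 + 1) * (2 * x.length + 4) + 3 := (((hLn.const_mul 2).add_const 4).const_mul (c0 + 1)).add_const 3
    have hT1 : PolyBd fun x => 2 * x.length + 2 + 2 * (x.length + Dp * p.eval x.length) + p.eval x.length + 8 :=
      (((((hLn.const_mul 2).add_const 2).add ((hLn.add (hPe.const_mul Dp)).const_mul 2)).add hPe).add_const 8)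
    have hT2 : PolyBd fun x => (c2 + 1) * (x.length + Dp * p.eval x.length + 2) + 3 :=
      (((hLn.add (hPe.const_mul Dp)).add_const 2).const_mul (c2 + 1)).add_const 3
    have hT3 : PolyBd fun x => 2 * E x + 6 + ((cb + 1) + 3 + mc x) + 8 :=
      ((((hE.const_mul 2).add_const 6).add (((PolyBd.const (cb + 1)).add_const 3).add hmc)).add_const 8)
    have hT5 : PolyBd fun _ : List Bool => (c5 + 1) * 4 + 3 := PolyBd.const _
    rw [hPdef]
    exact ((((hQe.add hT0).add hT1).add hT2).add hT3).add hT5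
  obtain ⟨A, hA⟩ := hP
  refine ⟨N, A, fun x => ?_⟩
  -- abbreviations
  set φ := kcnfOf k x with hφ
  set g := decide (Good k x) with hg
  set d := decide φ.compact.Satisfiable with hd
  -- stage q: padding
  have sq : Mq.OutputsWithin x (padTranscriptFn x) (q.eval x.length) := hq x
  -- stage 0: the input splitter
  have s0 : M0.OutputsWithin (padTranscriptFn x) (x.map some ++ none :: [none]) ((c0 + 1) * (padTranscriptFn x).length + 3) := by
    have := h0 (padTranscriptFn x)
    rw [id, padTranscriptFn_apply, tr0, inT_eval, ansCtx_nil] at this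
    rwa [padTranscriptFn_apply, tr0]
  -- stage 1: the front end on the first field
  have s1 : M1.OutputsWithin (x.map some ++ none :: [none]) ((preFn k x).map some ++ none :: [none])
      (2 * x.length + 2 * [none].length + 2 * (preFn k x).length + p.eval x.length + 8) :=
    ctx_outputsWithin Mp [none] (hp x)
  -- stage 2: the hand-over transducer
  have s2 : M2.OutputsWithin ((preFn k x).map some ++ none :: [none])
      (φ.encode.map some ++ none :: (some (Γ'.bit g) :: [none]))
      ((c2 + 1) * ((preFn k x).map some ++ none :: [none]).length + 3) := by
    have := h2 ((preFn k x).map some ++ none :: ([none] : List (Option Bool)))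
    rw [id, preFn_eq, midT_eval, ← encode_eq_kword] at this
    rwa [preFn_eq]
  -- stage 3: compaction, the given machine and the bit transliteration on the first field
  have s3 : M3.OutputsWithin (φ.encode.map some ++ none :: (some (Γ'.bit g) :: [none]))
      [some (Γ'.bit d), none, some (Γ'.bit g), none]
      (2 * φ.encode.length + 2 * (some (Γ'.bit g) :: [none]).length + 2 * [Γ'.bit d].length +
        (((cb + 1) * [d].length + 3 + T φ.compact) + cc * (φ.encode.length + 1) ^ cc) + 8) := by
    have hb' : Mb.OutputsWithin [d] [Γ'.bit d] ((cb + 1) * [d].length + 3) := by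
      have := hb [d]
      rwa [id, bitT_eval] at this
    have hd' : Md.OutputsWithin φ.compact.encode [d] (T φ.compact) := by
      have := hMd φ.compact
      rwa [Lemma3FP.encodeBool_eq] at this
    have inner := TM2ComputableAux.comp_outputsWithin Mc (Md.comp Mb) (hMc φ)
      (TM2ComputableAux.comp_outputsWithin Md Mb hd' hb')
    exact ctx_outputsWithin (Mc.comp (Md.comp Mb)) (some (Γ'.bit g) :: [none]) inner
  -- stage 5: the conjunction with the flag
  have s5 : M5.OutputsWithin [some (Γ'.bit d), none, some (Γ'.bit g), none] [decBit k x]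
      ((c5 + 1) * 4 + 3) := by
    have := h5 [some (Γ'.bit d), none, some (Γ'.bit g), none]
    rwa [id, finT_eval] at this
  have H := TM2ComputableAux.comp_outputsWithin _ M5
    (TM2ComputableAux.comp_outputsWithin _ M3
      (TM2ComputableAux.comp_outputsWithin _ M2
        (TM2ComputableAux.comp_outputsWithin _ M1
          (TM2ComputableAux.comp_outputsWithin Mq M0 sq s0) s1) s2) s3) s5
  refine H.mono ?_
  -- the lengths along the pipeline
  have lpad : (padTranscriptFn x).length = 2 * x.length + 4 := length_padTranscriptFn x
  have lpre : (preFn k x).length ≤ x.length + Dp * p.eval x.length := (hp x).length_le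
  have lE : φ.encode.length = E x := by rw [hEdef]
  have hmcx : mc x = cc * (E x + 1) ^ cc := by rw [hmcdef]
  have hPx : P x ≤ A * (x.length + 1) ^ A := hA x
  have hPx' : P x = q.eval x.length +
    ((c0 + 1) * (2 * x.length + 4) + 3) +
    (2 * x.length + 2 + 2 * (x.length + Dp * p.eval x.length) + p.eval x.length + 8) +
    ((c2 + 1) * (x.length + Dp * p.eval x.length + 2) + 3) +
    (2 * E x + 6 + ((cb + 1) + 3 + mc x) + 8) +
    ((c5 + 1) * 4 + 3) := by rw [hPdef]
  simp only [List.length_append, List.length_map, List.length_cons, List.length_nil, lpad, lE] at *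
  rw [← hmcx]
  have b2 : (c2 + 1) * ((preFn k x).length + (0 + 1 + 1)) + 3 ≤ (c2 + 1) * (x.length + Dp * p.eval x.length + 2) + 3 := by
    have : (preFn k x).length + (0 + 1 + 1) ≤ x.length + Dp * p.eval x.length + 2 := by omega
    exact Nat.add_le_add_right (Nat.mul_le_mul_left _ this) 3
  omega

/-- **`¬ ETH` puts `kSATParam 3` in `SE`**: for `ε > 0`, the decider `exists_decMachine` built on the
`Γ'`-machine of `KSATInExpTime 3 ε` runs in time `poly(|x|) + O(2^{ε n'} poly)` with `n' ≤ CNF.numVars`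
the parameter of the input (`numVars_compact_kcnfOf_le`) and decides `kSAT 3`
(`decBit_eq_boolIndicator`). [cite: ImpagliazzoPaturiZaneJCSS2001, §2 (SE; k-SAT with parameter n);
AroraBarak2009, §1.3] -/
theorem mem_SE_of_forall_kSATInExpTime (h : ∀ δ : ℝ, 0 < δ → KSATInExpTime 3 δ) : kSATParam 3 ∈ SE := by
  intro ε hε
  classical
  obtain ⟨T, ⟨cT, hcT⟩, hCT⟩ := h ε hε
  obtain ⟨Md, hMd⟩ := exists_computesInTime_iff.2 hCT
  obtain ⟨N, A, hN⟩ := exists_decMachine 3 (fun φ => T φ.numVars φ.encode.length) ⟨Md, fun φ => hMd φ⟩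
  let B : ℕ := 25 * (3 + 4)
  let cS : ℕ := A + cT * B ^ cT + 2 * cT + 1
  refine ⟨fun x => A * (x.length + 1) ^ A +
      T (KCNF.compact (kcnfOf 3 x)).numVars (KCNF.compact (kcnfOf 3 x)).encode.length, N, ⟨cS, fun x => ?_⟩, fun x => ?_⟩
  · -- the time is within the `SE` bound for `ε`
    have e1 := length_encode_compact_kcnfOf_le 3 x
    have en := numVars_compact_kcnfOf_le 3 x
    have hT := hcT (KCNF.compact (kcnfOf 3 x)).numVars (KCNF.compact (kcnfOf 3 x)).encode.length
    show (((A * (x.length + 1) ^ A +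
        T (KCNF.compact (kcnfOf 3 x)).numVars (KCNF.compact (kcnfOf 3 x)).encode.length : ℕ)) : ℝ) ≤ _
    -- make the data opaque: only the inequalities matter from here on
    generalize KCNF.compact (kcnfOf 3 x) = φ' at e1 en hT ⊢
    generalize (kSATParam 3).param x = pm at en ⊢
    generalize φ'.numVars = nv at en hT ⊢
    generalize φ'.encode.length = Le at e1 hT ⊢
    generalize T nv Le = t at hT ⊢
    generalize x.length = L at e1 ⊢
    -- in `ℕ`: the compacted formula is polynomially long
    have hB : Le + 1 ≤ B * (L + 1) ^ 2 := by
      have e2 : (2 * L + 5) ^ 2 ≤ 25 * (L + 1) ^ 2 :=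
        calc (2 * L + 5) ^ 2 ≤ (5 * (L + 1)) ^ 2 := Nat.pow_le_pow_left (by omega) 2
          _ = 25 * (L + 1) ^ 2 := by ring
      have e3 : 1 ≤ 25 * (L + 1) ^ 2 := by nlinarith
      calc Le + 1 ≤ (3 + 3) * (25 * (L + 1) ^ 2) + 25 * (L + 1) ^ 2 :=
            Nat.add_le_add (e1.trans (Nat.mul_le_mul_left _ e2)) e3
        _ = B * (L + 1) ^ 2 := by simp only [B]; ring
    -- in `ℝ`
    set P : ℝ := (2 : ℝ) ^ (ε * (pm : ℝ)) with hP
    set S : ℝ := (L : ℝ) + 1 with hS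
    have hP1 : 1 ≤ P := Real.one_le_rpow one_le_two (by positivity)
    have hS1 : 1 ≤ S := by simp only [hS]; linarith [Nat.cast_nonneg (α := ℝ) L]
    have hX : 0 ≤ P * S ^ cS := by positivity
    -- (a) the polynomial part
    have ha : ((A * (L + 1) ^ A : ℕ) : ℝ) ≤ A * (P * S ^ cS) := by
      push_cast
      rw [← hS]
      have f1 : S ^ A ≤ S ^ cS := pow_le_pow_right₀ hS1 (by simp only [cS]; omega)
      have f2 : S ^ cS ≤ P * S ^ cS := by
        calc S ^ cS = 1 * S ^ cS := by ring
          _ ≤ P * S ^ cS := by gcongr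
      exact mul_le_mul_of_nonneg_left (f1.trans f2) (Nat.cast_nonneg A)
    -- (b) the part of the given machine
    have hb : ((t : ℕ) : ℝ) ≤ (cT * B ^ cT : ℕ) * (P * S ^ cS) := by
      have f2 : (2 : ℝ) ^ (ε * (nv : ℝ)) ≤ P :=
        Real.rpow_le_rpow_of_exponent_le one_le_two (mul_le_mul_of_nonneg_left (by exact_mod_cast en) hε.le)
      have f3 : ((Le : ℝ) + 1) ≤ (B : ℝ) * S ^ 2 := by simp only [hS]; exact_mod_cast hB
      have f4 : ((Le : ℝ) + 1) ^ cT ≤ ((B : ℝ) * S ^ 2) ^ cT :=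
        pow_le_pow_left₀ (by linarith [Nat.cast_nonneg (α := ℝ) Le]) f3 cT
      rw [mul_pow, ← pow_mul] at f4
      have f6 : S ^ (2 * cT) ≤ S ^ cS := pow_le_pow_right₀ hS1 (by simp only [cS]; omega)
      have f7 : ((Le : ℝ) + 1) ^ cT ≤ (B : ℝ) ^ cT * S ^ cS := f4.trans (mul_le_mul_of_nonneg_left f6 (by positivity))
      have f8 : (t : ℝ) ≤ cT * P * ((B : ℝ) ^ cT * S ^ cS) :=
        hT.trans (by gcongr)
      push_cast
      calc (t : ℝ) ≤ cT * P * ((B : ℝ) ^ cT * S ^ cS) := f8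
        _ = (cT * (B : ℝ) ^ cT) * (P * S ^ cS) := by ring
    have hcS : ((A : ℝ) + (cT * B ^ cT : ℕ)) ≤ (cS : ℝ) := by
      have : A + cT * B ^ cT ≤ cS := by simp only [cS]; omega
      exact_mod_cast this
    calc (((A * (L + 1) ^ A + t : ℕ)) : ℝ)
        = ((A * (L + 1) ^ A : ℕ) : ℝ) + ((t : ℕ) : ℝ) := by push_cast; ring
      _ ≤ A * (P * S ^ cS) + (cT * B ^ cT : ℕ) * (P * S ^ cS) := add_le_add ha hb
      _ = ((A : ℝ) + (cT * B ^ cT : ℕ)) * (P * S ^ cS) := by ring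
      _ ≤ (cS : ℝ) * (P * S ^ cS) := mul_le_mul_of_nonneg_right hcS hX
      _ = (cS : ℝ) * P * S ^ cS := by ring
  · -- the machine decides `kSAT 3`
    have := hN x
    rw [decBit_eq_boolIndicator] at this
    rw [id, kSATParam_lang, Lemma3FP.encodeBool_eq]
    exact this

/-! ### The two parameters -/

/-- **`3`-SAT with parameter `n` is in `SE` iff `3`-SAT with parameter `m` is** (Impagliazzo–Paturi–Zane
2001, §2, the two directions of Corollary 2's SERF-equivalence): `SE` is closed under SERF reductions
(`mem_SE_of_serfReducible_holds`) and the two problems SERF-reduce to each other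
(`serfReducible_kSATParam_kSATClauseParam_holds`, by sparsification, and
`serfReducible_kSATClauseParam_kSATParam_holds`). [cite: ImpagliazzoPaturiZaneJCSS2001, §2 Cor. 1–2 and
§2.1 (SE closed under SERF)] -/
theorem kSATParam_mem_SE_iff (k : ℕ) : kSATParam k ∈ SE ↔ kSATClauseParam k ∈ SE :=
  ⟨fun h => mem_SE_of_serfReducible_holds (serfReducible_kSATClauseParam_kSATParam_holds k) h,
    fun h => mem_SE_of_serfReducible_holds (serfReducible_kSATParam_kSATClauseParam_holds k) h⟩

end EthBridge

end SerfKSat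

/-! ### The discharges -/

open SerfKSat.EthBridge in
/-- **Discharge of `eth_iff_kSATParam_three_not_mem_SE`: `ETH ↔ kSATParam 3 ∉ SE`.** The `Wave0`
formulation of ETH (for some `δ > 0` no multi-stack machine decides the `Γ'`-coded `3`-CNFs in time
`2^{δ n} · poly(L)`, `n` the declared number of variables) is equivalent to non-membership in `SE` of
`3`-SAT coded over `{0,1}` with parameter `CNF.numVars`: both encodings are inter-translatable in
polynomial time with the parameter preserved up to renaming unused variables
(`kSATInExpTime_of_mem_SE`, `mem_SE_of_forall_kSATInExpTime`), and `¬ ETH ↔ ∀ δ > 0, KSATInExpTime 3 δ`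
(`not_eth_iff`). Encoding bridge between two formalisations of the same printed notion
(Impagliazzo–Paturi–Zane 2001, §2: `SE` and "k-SAT with parameter n"). [folklore] -/
theorem eth_iff_kSATParam_three_not_mem_SE_holds : eth_iff_kSATParam_three_not_mem_SE := by
  show ETH ↔ kSATParam 3 ∉ SE
  rw [← not_iff_not, not_not, not_eth_iff]
  exact ⟨mem_SE_of_forall_kSATInExpTime, fun h δ hδ => kSATInExpTime_of_mem_SE h hδ⟩

open SerfKSat.EthBridge in
/-- **Discharge of `eth_iff_kSATClauseParam_not_mem_SE` (Impagliazzo–Paturi–Zane 2001, Corollary 2):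
`ETH ↔ kSATClauseParam 3 ∉ SE`** — ETH holds iff `3`-SAT with parameter `m`, the number of clauses
(equivalently linear-size `3`-SAT), is not subexponential. By the bridge
`eth_iff_kSATParam_three_not_mem_SE_holds` and the SERF-equivalence of the two parameters
(`kSATParam_mem_SE_iff`: sparsification one way, renaming the other, and closure of `SE` under SERF
reductions). [cite: ImpagliazzoPaturiZaneJCSS2001, §2 Cor. 2] -/
theorem eth_iff_kSATClauseParam_not_mem_SE_holds : eth_iff_kSATClauseParam_not_mem_SE := by
  show ETH ↔ kSATClauseParam 3 ∉ SE
  rw [show (ETH ↔ kSATClauseParam 3 ∉ SE) ↔ (ETH ↔ kSATParam 3 ∉ SE) from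
    iff_congr Iff.rfl (not_congr (kSATParam_mem_SE_iff 3).symm)]
  exact eth_iff_kSATParam_three_not_mem_SE_holds

end Literature.Computability.FineGrained
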